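import Mathlib
import Summits.NavierStokesRegularity.FluidComputer.TransportGalerkinExistence
import Summits.NavierStokesRegularity.FluidComputer.LatticeSqWeightsRapidDecay
import HarnessLib

/-!
# Galerkin limit of the transport model, XIX: THE solution is SMOOTH IN SPACE on the window (instab g20, cell `ns-blowup`, 2026-08-27)

HONEST FRAMING (human ruling D-0035): nothing here is a claim about Navier–Stokes blow-up.
WHAT THIS IS NOT: not NS — a MODEL theorem schema (perturbation equation about a smooth host on
`𝕋^d` in the scaled phase space `E = lp (ℤ^d → V) 2`). No number or census word moves.

PURPOSE. `TransportGalerkinExistence.exists_solution_of_levelBound` (g20, part XVII) produces THE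
classical solution of the model on the window as the `C⁰`-limit of the Galerkin levels, in the class
«uniform polynomial tail of scaled order `d + 3`» over which the KEEP/KILL words quantify. The order
`d + 3` there is only the order the Wilczak–Zgliczyński box needs; the residence mechanism of g19
(`TransportGalerkinResidence.energy_le_of_energy_three_le`) bounds EVERY Sobolev order of the levels
uniformly on the window once order three is bounded. This file records the consequence:

* `exists_residence_radius_of_order` — g19's residence box at an ARBITRARY order `σ ≥ 1`: one
  constant `C_σ` with `‖(y i t) k‖ ≤ C_σ ⟨k⟩^{−(σ−2)}` for a bounded family of Galerkin trajectories;
* `rapidDecay_of_forall_norm_le` — a lattice family under polynomial floors of every order is rapidly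
  decreasing (`LatticeSqWeightsRapidDecay.rapidDecay_of_summable_sq_weights`);
* `smooth_of_tendstoUniformlyOn` — the uniform limit `w` of the levels of a rapidly decreasing seed
  with ONE `E`-bound has uniform polynomial tails of EVERY order on `[0, T]` (the same constants as the
  levels) and `⇑(w t)` is RAPIDLY DECREASING for every `t ∈ [0, T]`: THE solution is `C^∞` in space;
* `rapidDecay_of_solution` — hence every classical solution in the order-`(d+3)` class from the seed
  (which IS that limit, `TransportGalerkinExistence.tendstoUniformlyOn_of_solution`) is smooth in space.

Applies verbatim to THE solution of `TransportGalerkinAbcSolution.exists_keep_solution_abc_final` /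
`exists_kill_solution_abc_final` (forced ABC on `𝕋³`). General finite `d`, Hilbert proper `V`;
Mathlib + the tree files cited; no new definitions.
-/

noncomputable section

open scoped ENNReal NNReal ComplexConjugate InnerProductSpace
open Set Filter Topology

namespace Summit.NavierStokesRegularity.FluidComputer.TransportGalerkinSmooth

open RCLike
open Literature.Analysis.FunctionSpaces Literature.Analysis.FunctionSpaces.Lattice
open Literature.Analysis.FunctionSpaces.Torus
open Literature.Analysis.ODE
open Summit.NavierStokesRegularity.FluidComputer.GalerkinLatticePhaseSpace
open Summit.NavierStokesRegularity.FluidComputer.TransportGalerkin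
open Summit.NavierStokesRegularity.FluidComputer.TransportGalerkinRapid
open Summit.NavierStokesRegularity.FluidComputer.TransportGalerkinBox
open Summit.NavierStokesRegularity.FluidComputer.TransportGalerkinResidencePrep
open Summit.NavierStokesRegularity.FluidComputer.TransportGalerkinResidence
open Summit.NavierStokesRegularity.FluidComputer.TransportGalerkinResidenceBox
open Summit.NavierStokesRegularity.FluidComputer.TransportGalerkinEmergenceH2
open Summit.NavierStokesRegularity.FluidComputer.TransportGalerkinExistence
open Summit.NavierStokesRegularity.FluidComputer.LatticeSqWeightsRapidDecay

variable {d : Type*} [Fintype d] [DecidableEq d]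
variable {V : Type*} [NormedAddCommGroup V] [InnerProductSpace ℂ V] [CompleteSpace V] [ProperSpace V]
variable {ν : ℝ} {Uv : (d → ℤ) → V} {π : d → (V →L[ℂ] ℂ)} {P : (d → ℤ) → (V →L[ℂ] V)}

/-! ## §1 The residence box at an arbitrary order -/

section Radius

omit [ProperSpace V] in
/-- **ONE polynomial radius of ARBITRARY order for a bounded family of Galerkin levels**
(`exists_residence_radius_of_order`): as `TransportGalerkinExistence.exists_residence_radius`, at
any order `σ ≥ 1` — host with `ν > 0`; trajectories `y i` on `[0, T]`, right-differentiable on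
`[0, T)` with `(y i)' = P_{N i} F(y i)`, `P_{N i}`-fixed, in `box ρ₀ π P` (linear clauses), with common
bounds `‖y i t‖ ≤ r`, `E₃` on the initial order-three energies and `E_σ` on the initial order-`σ`
energies. Conclusion: `‖(y i t) k‖ ≤ C_σ ⟨k⟩^{−(σ−2)}` for every `i`, `t ∈ [0, T]`, `k`, one `C_σ ≥ 0`. -/
theorem exists_residence_radius_of_order (hν : 0 < ν) (hUv : RapidDecay Uv) (hπ : ∀ j, ‖π j‖ ≤ 1)
    (hUreal : ∀ j p, π j (Uv (-p)) = conj (π j (Uv p)))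
    (hUdiv : ∑ j, freqDeriv j (fun p => π j (Uv p)) = 0)
    (hPsa : ∀ k, IsSelfAdjoint (P k)) (hP : ∀ k, ‖P k‖ ≤ 1)
    (hσ₂ : ∑' l : d → ℤ, ENNReal.ofReal (sobolevWeight (-2) l ^ 2) < ∞)
    {σ : ℕ} (hσ1 : 1 ≤ σ) {ρ₀ : (d → ℤ) → ℝ}
    {ι : Type*} {N : ι → ℕ} {y : ι → ℝ → lp (fun _ : (d → ℤ) => V) 2} {T r E₃ Eσ : ℝ}
    (hr : 0 < r) (hE₃ : 0 ≤ E₃) (hEσ : 0 ≤ Eσ)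
    (hcont : ∀ i, ContinuousOn (y i) (Icc 0 T))
    (hderiv : ∀ i, ∀ t ∈ Ico 0 T,
      HasDerivWithinAt (y i) (cubeProj (N i) (nsField ν Uv π P (y i t))) (Ici t) t)
    (hproj : ∀ i, ∀ t ∈ Icc 0 T, cubeProj (N i) (y i t) = y i t)
    (hW : ∀ i, ∀ t ∈ Icc 0 T, y i t ∈ box ρ₀ π P)
    (hbd : ∀ i, ∀ t ∈ Icc 0 T, ‖y i t‖ ≤ r)
    (h3 : ∀ i, (eNormSq 3 (wmul (-2) ⇑(y i 0))).toReal ≤ E₃)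
    (hσ0 : ∀ i, (eNormSq (σ : ℝ) (wmul (-2) ⇑(y i 0))).toReal ≤ Eσ) :
    ∃ Cσ : ℝ, 0 ≤ Cσ ∧ ∀ i, ∀ t ∈ Icc 0 T, ∀ k,
      ‖(y i t : (d → ℤ) → V) k‖ ≤ Cσ * sobolevWeight (-((σ : ℝ) - 2)) k := by
  -- the order-three constants (as in `energy_three_le`)
  set α₃ : ℝ := 2 * ν * (2 * Real.pi) ^ 2
      + 2 * ((3 * (2 : ℝ) ^ 3) * (2 * Real.pi) *
          (∑ j, (symbNorm (3 : ℝ) (scal (fun p => π j (Uv p)) : (d → ℤ) → (V →L[ℂ] V))).toReal)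
        + (2 : ℝ) ^ ((3 : ℝ) / 2) * ((Fintype.card d : ℝ) * (2 * Real.pi)) *
          (∑' l, ENNReal.ofReal (sobolevWeight 4 l) * ‖Uv l‖ₑ).toReal) with hα₃
  set β₃ : ℝ := 27 * (2 * ((Fintype.card d : ℝ) * (3 * (2 : ℝ) ^ 3) * (2 * Real.pi)) *
          Real.sqrt (∑' l : d → ℤ, ENNReal.ofReal (sobolevWeight (-2) l ^ 2)).toReal) ^ 4 /
      (256 * (2 * ν * (2 * Real.pi) ^ 2 / r ^ 2) ^ 3) with hβ₃
  have hα₃0 : 0 ≤ α₃ := by positivity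
  have hβ₃0 : 0 ≤ β₃ := by positivity
  set R₃ : ℝ := (E₃ + β₃ * |T|) * Real.exp (α₃ * |T|) with hR₃
  have hR₃0 : 0 ≤ R₃ := by positivity
  -- order three on the window
  have hS3 : ∀ i, ∀ t ∈ Icc 0 T, (eNormSq 3 (wmul (-2) ⇑(y i t))).toReal ≤ R₃ := by
    intro i t ht
    have hT : T = |T| := (abs_of_nonneg (ht.1.trans ht.2)).symm
    have h := energy_three_le hν hUv hπ hUreal hUdiv hPsa hP hσ₂ hr (hcont i) (hderiv i) (hproj i)
      (hW i) (hbd i) t ht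
    refine h.trans ((gronwallBound_le_window ENNReal.toReal_nonneg hα₃0 hβ₃0 ht.1
      (ht.2.trans_eq hT)).trans ?_)
    rw [hR₃]
    exact mul_le_mul_of_nonneg_right (add_le_add_left (h3 i) _) (Real.exp_pos _).le
  -- order σ on the window
  set ασ : ℝ := 2 * ν * (2 * Real.pi) ^ 2
      + 2 * ((σ * (2 : ℝ) ^ σ) * (2 * Real.pi) *
          (∑ j, (symbNorm (σ : ℝ) (scal (fun p => π j (Uv p)) : (d → ℤ) → (V →L[ℂ] V))).toReal)
        + (2 : ℝ) ^ ((σ : ℝ) / 2) * ((Fintype.card d : ℝ) * (2 * Real.pi)) *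
          (∑' l, ENNReal.ofReal (sobolevWeight ((σ : ℝ) + 1) l) * ‖Uv l‖ₑ).toReal)
      + 2 * ((Fintype.card d : ℝ) * (σ * (2 : ℝ) ^ σ) * (2 * Real.pi)) *
          Real.sqrt (∑' l : d → ℤ, ENNReal.ofReal (sobolevWeight (-2) l ^ 2)).toReal *
          Real.sqrt R₃ with hασ
  have hασ0 : 0 ≤ ασ := by positivity
  set R : ℝ := Eσ * Real.exp (ασ * |T|) with hR
  have hSσ : ∀ i, ∀ t ∈ Icc 0 T, (eNormSq (σ : ℝ) (wmul (-2) ⇑(y i t))).toReal ≤ R := by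
    intro i t ht
    have hT : t ≤ |T| := ht.2.trans (le_abs_self T)
    have h := energy_le_of_energy_three_le hν.le hUv hπ hUreal hUdiv hPsa hP hσ₂ hσ1 hR₃0 (hcont i)
      (hderiv i) (hproj i) (hW i) (hS3 i) t ht
    refine h.trans ?_
    rw [hR]
    exact mul_le_mul (hσ0 i) (Real.exp_le_exp.2 (mul_le_mul_of_nonneg_left hT hασ0))
      (Real.exp_pos _).le hEσ
  -- the radius
  refine ⟨Real.sqrt R, Real.sqrt_nonneg _, fun i t ht k => ?_⟩
  have hxr : RapidDecay (⇑(y i t)) := by rw [← hproj i t ht]; exact rapidDecay_coe_cubeProj (N i) (y i t)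
  have hfin : eNormSq ((σ : ℝ) - 2) (⇑(y i t)) < ∞ := eNormSq_lt_top_of_rapidDecay hxr _
  have hle : (eNormSq ((σ : ℝ) - 2) (⇑(y i t))).toReal ≤ R := by
    rw [← eNormSq_unscale]; exact hSσ i t ht
  exact norm_apply_le_of_eNormSq_le hfin hle k

end Radius

/-! ## §2 Polynomial floors of every order ⇒ rapid decay -/

section Rapid

omit [DecidableEq d] [InnerProductSpace ℂ V] [CompleteSpace V] [ProperSpace V] in
/-- **A lattice family under a polynomial floor of EVERY order is rapidly decreasing**
(`rapidDecay_of_forall_norm_le`): if for every `σ : ℕ` there is `C` with `‖c k‖ ≤ C ⟨k⟩^{−σ}`, then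
`RapidDecay c` (order `s + card d + 1` against `∑⟨k⟩^{−2(card d+1)} < ∞`,
`LatticeSqWeightsRapidDecay.rapidDecay_of_summable_sq_weights`). -/
theorem rapidDecay_of_forall_norm_le {c : (d → ℤ) → V}
    (h : ∀ σ : ℕ, ∃ C : ℝ, ∀ k, ‖c k‖ ≤ C * sobolevWeight (-(σ : ℝ)) k) : RapidDecay c := by
  refine rapidDecay_of_summable_sq_weights fun s => ?_
  obtain ⟨C, hC⟩ := h (s + (Fintype.card d + 1))
  have hsum := (summable_sobolevWeight_neg_sq (d := d) (t := (Fintype.card d : ℝ) + 1)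
    (by linarith [Nat.cast_nonneg (α := ℝ) (Fintype.card d)])).mul_left (C ^ 2)
  refine Summable.of_nonneg_of_le (fun k => mul_nonneg (pow_nonneg
    (by linarith [freqNormSq_nonneg k]) _) (sq_nonneg _)) (fun k => ?_) hsum
  have hexp : (s : ℝ) + -(((s + (Fintype.card d + 1) : ℕ) : ℝ)) = -((Fintype.card d : ℝ) + 1) := by
    push_cast; ring
  have h1 : ‖c k‖ ^ 2 ≤ (C * sobolevWeight (-(((s + (Fintype.card d + 1) : ℕ) : ℝ))) k) ^ 2 :=
    pow_le_pow_left₀ (norm_nonneg _) (hC k) 2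
  calc (1 + freqNormSq k) ^ s * ‖c k‖ ^ 2
      ≤ sobolevWeight (s : ℝ) k ^ 2 * (C * sobolevWeight (-(((s + (Fintype.card d + 1) : ℕ) : ℝ))) k) ^ 2 := by
        rw [← sobolevWeight_natCast_sq]
        exact mul_le_mul_of_nonneg_left h1 (sq_nonneg _)
    _ = C ^ 2 * (sobolevWeight (s : ℝ) k * sobolevWeight (-(((s + (Fintype.card d + 1) : ℕ) : ℝ))) k) ^ 2 := by
        ring
    _ = C ^ 2 * sobolevWeight (-((Fintype.card d : ℝ) + 1)) k ^ 2 := by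
        rw [← sobolevWeight_add, hexp]

end Rapid

/-! ## §3 The limit of the levels is smooth in space -/

section Smooth

omit [ProperSpace V] in
/-- **The uniform limit of the levels is SMOOTH IN SPACE on the window**
(`smooth_of_tendstoUniformlyOn`). Host with `ν > 0`; a rapidly decreasing seed `z`; its levels
`u n` at `cubeProj (n + K)` on `[0, T]` as `C¹` solutions of the Galerkin ODE keeping the three linear
clauses with ONE `E`-bound `‖u n t‖ ≤ r`; `w` any uniform limit of the levels on `[0, T]` (THE solution
of `TransportGalerkinExistence.exists_solution_of_levelBound`). Conclusion: for EVERY order `σ : ℕ` one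
constant `C_σ ≥ 0` with `‖(u n t) k‖ ≤ C_σ ⟨k⟩^{−σ}` AND `‖(w t) k‖ ≤ C_σ ⟨k⟩^{−σ}` for all `n`,
`t ∈ [0, T]`, `k`; and `⇑(w t)` is rapidly decreasing for every `t ∈ [0, T]`. -/
theorem smooth_of_tendstoUniformlyOn (K : ℕ) (hν : 0 < ν) (hUv : RapidDecay Uv)
    (hUreal : ∀ j p, π j (Uv (-p)) = conj (π j (Uv p)))
    (hUdiv : ∑ j, freqDeriv j (fun p => π j (Uv p)) = 0) (hπ : ∀ j, ‖π j‖ ≤ 1)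
    (hPsa : ∀ k, IsSelfAdjoint (P k)) (hPn : ∀ k, ‖P k‖ ≤ 1)
    (hσ : ∑' l : d → ℤ, ENNReal.ofReal (sobolevWeight (-2) l ^ 2) < ∞)
    {T : ℝ} {z : lp (fun _ : (d → ℤ) => V) 2} (hzr : RapidDecay (⇑z))
    {u : ℕ → ℝ → lp (fun _ : (d → ℤ) => V) 2} {r : ℝ} (hr : 0 < r)
    (sol_continuousOn : ∀ n, ContinuousOn (u n) (Icc 0 T))
    (sol_init : ∀ n, u n 0 = cubeProj (n + K) z)
    (sol_hasDerivWithinAt : ∀ n, ∀ t ∈ Icc 0 T,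
      HasDerivWithinAt (u n) (cubeProj (n + K) (nsField ν Uv π P (u n t))) (Icc 0 T) t)
    (sol_proj : ∀ n, ∀ t ∈ Icc 0 T, cubeProj (n + K) (u n t) = u n t)
    (sol_fix : ∀ n, ∀ t ∈ Icc 0 T, ∀ k, P k ((u n t : (d → ℤ) → V) k) = (u n t : (d → ℤ) → V) k)
    (sol_real : ∀ n, ∀ t ∈ Icc 0 T, ∀ j k,
      π j ((u n t : (d → ℤ) → V) (-k)) = conj (π j ((u n t : (d → ℤ) → V) k)))
    (sol_div : ∀ n, ∀ t ∈ Icc 0 T, ∀ k, ∑ j, ((k j : ℤ) : ℂ) * π j ((u n t : (d → ℤ) → V) k) = 0)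
    (sol_bound : ∀ n, ∀ t ∈ Icc 0 T, ‖u n t‖ ≤ r)
    {w : ℝ → lp (fun _ : (d → ℤ) => V) 2} (hconv : TendstoUniformlyOn (fun n t => u n t) w atTop (Icc 0 T)) :
    (∀ σ : ℕ, ∃ Cσ : ℝ, 0 ≤ Cσ ∧
      (∀ n, ∀ t ∈ Icc 0 T, ∀ k, ‖(u n t : (d → ℤ) → V) k‖ ≤ Cσ * sobolevWeight (-(σ : ℝ)) k) ∧
      (∀ t ∈ Icc 0 T, ∀ k, ‖(w t : (d → ℤ) → V) k‖ ≤ Cσ * sobolevWeight (-(σ : ℝ)) k)) ∧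
    ∀ t ∈ Icc 0 T, RapidDecay (⇑(w t)) := by
  -- initial energies of the levels are dominated by those of the seed (every order)
  have hzr' : RapidDecay (wmul (-2) (⇑z)) := rapidDecay_wmul hzr (-2)
  have hinit : ∀ s : ℝ, ∀ n, (eNormSq s (wmul (-2) ⇑(u n 0))).toReal ≤ (eNormSq s (wmul (-2) ⇑z)).toReal :=
    fun s n => by
      rw [sol_init n]
      exact ENNReal.toReal_mono (eNormSq_lt_top_of_rapidDecay hzr' _).ne (eNormSq_unscale_cubeProj_le _ _ _)
  -- the levels lie in the coarse box of radius `r` (linear clauses + the `E`-bound)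
  have hWr : ∀ n, ∀ t ∈ Icc 0 T, u n t ∈ box (fun _ => r) π P := fun n t ht =>
    mem_box.2 ⟨fun k => (norm_apply_le (u n t) k).trans (sol_bound n t ht), sol_fix n t ht,
      sol_real n t ht, sol_div n t ht⟩
  -- right derivatives on `[0, T)`
  have hderiv : ∀ n, ∀ t ∈ Ico 0 T,
      HasDerivWithinAt (u n) (cubeProj (n + K) (nsField ν Uv π P (u n t))) (Ici t) t := by
    intro n t ht
    refine (sol_hasDerivWithinAt n t (Ico_subset_Icc_self ht)).mono_of_mem_nhdsWithin ?_
    exact Set.ordConnected_Icc.mem_nhdsGE (Ico_subset_Icc_self ht) (right_mem_Icc.2 (ht.1.trans ht.2.le)) ht.2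
  -- every order, levels and limit
  have hall : ∀ σ : ℕ, ∃ Cσ : ℝ, 0 ≤ Cσ ∧
      (∀ n, ∀ t ∈ Icc 0 T, ∀ k, ‖(u n t : (d → ℤ) → V) k‖ ≤ Cσ * sobolevWeight (-(σ : ℝ)) k) ∧
      (∀ t ∈ Icc 0 T, ∀ k, ‖(w t : (d → ℤ) → V) k‖ ≤ Cσ * sobolevWeight (-(σ : ℝ)) k) := by
    intro σ
    obtain ⟨Cσ, hC0, hrad⟩ := exists_residence_radius_of_order (σ := σ + 2) (ι := ℕ) (N := fun n => n + K)
      (y := u) hν hUv hπ hUreal hUdiv hPsa hPn hσ (by omega) hr ENNReal.toReal_nonneg ENNReal.toReal_nonneg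
      sol_continuousOn hderiv sol_proj hWr sol_bound (hinit 3) (hinit ((σ + 2 : ℕ) : ℝ))
    have hexp : -((((σ + 2 : ℕ) : ℝ)) - 2) = -(σ : ℝ) := by push_cast; ring
    have hlev : ∀ n, ∀ t ∈ Icc 0 T, ∀ k, ‖(u n t : (d → ℤ) → V) k‖ ≤ Cσ * sobolevWeight (-(σ : ℝ)) k :=
      fun n t ht k => by rw [← hexp]; exact hrad n t ht k
    refine ⟨Cσ, hC0, hlev, fun t ht k => ?_⟩
    -- pass to the limit in the coordinate `k`
    have h1 : Tendsto (fun n => ‖(u n t : (d → ℤ) → V) k‖) atTop (𝓝 ‖(w t : (d → ℤ) → V) k‖) :=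
      (((continuous_apply_coe k).tendsto (w t)).comp (hconv.tendsto_at ht)).norm
    exact le_of_tendsto' h1 fun n => hlev n t ht k
  refine ⟨hall, fun t ht => rapidDecay_of_forall_norm_le fun σ => ?_⟩
  obtain ⟨Cσ, -, -, hw⟩ := hall σ
  exact ⟨Cσ, hw t ht⟩

/-- **Every classical solution in the class is smooth in space** (`rapidDecay_of_solution`): under
the hypotheses of `TransportGalerkinExistence.exists_solution_of_levelBound` (`T ≥ 0`, constrained
rapidly decreasing seed `z`, levels with one `E`-bound), a classical solution `w` on `[0, T]` from `z`
with a uniform polynomial tail of scaled order `d + 3` and the three clauses has `⇑(w t)` rapidly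
decreasing for every `t ∈ [0, T]` (it is the uniform limit of the levels,
`TransportGalerkinExistence.tendstoUniformlyOn_of_solution`, and `smooth_of_tendstoUniformlyOn`). -/
theorem rapidDecay_of_solution (K : ℕ) (hν : 0 < ν) (hUv : RapidDecay Uv)
    (hUreal : ∀ j p, π j (Uv (-p)) = conj (π j (Uv p)))
    (hUdiv : ∑ j, freqDeriv j (fun p => π j (Uv p)) = 0) (hπ : ∀ j, ‖π j‖ ≤ 1)
    (hPsa : ∀ k, IsSelfAdjoint (P k)) (hPn : ∀ k, ‖P k‖ ≤ 1)
    (hσ : ∑' l : d → ℤ, ENNReal.ofReal (sobolevWeight (-2) l ^ 2) < ∞)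
    {T : ℝ} (hT : 0 ≤ T)
    {z : lp (fun _ : (d → ℤ) => V) 2} (hzr : RapidDecay (⇑z))
    (hzfix : ∀ k, P k (z k) = z k) (hzreal : ∀ j k, π j (z (-k)) = conj (π j (z k)))
    (hzdiv : ∀ k, ∑ j, ((k j : ℤ) : ℂ) * π j (z k) = 0)
    {u : ℕ → ℝ → lp (fun _ : (d → ℤ) => V) 2} {r : ℝ} (hr : 0 < r)
    (sol_continuousOn : ∀ n, ContinuousOn (u n) (Icc 0 T))
    (sol_init : ∀ n, u n 0 = cubeProj (n + K) z)
    (sol_hasDerivWithinAt : ∀ n, ∀ t ∈ Icc 0 T,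
      HasDerivWithinAt (u n) (cubeProj (n + K) (nsField ν Uv π P (u n t))) (Icc 0 T) t)
    (sol_proj : ∀ n, ∀ t ∈ Icc 0 T, cubeProj (n + K) (u n t) = u n t)
    (sol_fix : ∀ n, ∀ t ∈ Icc 0 T, ∀ k, P k ((u n t : (d → ℤ) → V) k) = (u n t : (d → ℤ) → V) k)
    (sol_real : ∀ n, ∀ t ∈ Icc 0 T, ∀ j k,
      π j ((u n t : (d → ℤ) → V) (-k)) = conj (π j ((u n t : (d → ℤ) → V) k)))
    (sol_div : ∀ n, ∀ t ∈ Icc 0 T, ∀ k, ∑ j, ((k j : ℤ) : ℂ) * π j ((u n t : (d → ℤ) → V) k) = 0)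
    (sol_bound : ∀ n, ∀ t ∈ Icc 0 T, ‖u n t‖ ≤ r)
    {w : ℝ → lp (fun _ : (d → ℤ) => V) 2} (hw : ContinuousOn w (Icc 0 T)) (hw0 : w 0 = z)
    (hw' : ∀ t ∈ Ioo 0 T, HasDerivAt w (nsField ν Uv π P (w t)) t)
    {Cw : ℝ} (hCw : 0 ≤ Cw)
    (hwdec : ∀ t ∈ Icc 0 T, ∀ k, ‖(w t : (d → ℤ) → V) k‖ ≤ Cw * sobolevWeight (-((Fintype.card d : ℝ) + 3)) k)
    (hwfix : ∀ t ∈ Icc 0 T, ∀ k, P k ((w t : (d → ℤ) → V) k) = (w t : (d → ℤ) → V) k)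
    (hwreal : ∀ t ∈ Icc 0 T, ∀ j k, π j ((w t : (d → ℤ) → V) (-k)) = conj (π j ((w t : (d → ℤ) → V) k)))
    (hwdiv : ∀ t ∈ Icc 0 T, ∀ k, ∑ j, ((k j : ℤ) : ℂ) * π j ((w t : (d → ℤ) → V) k) = 0) :
    ∀ t ∈ Icc 0 T, RapidDecay (⇑(w t)) :=
  (smooth_of_tendstoUniformlyOn K hν hUv hUreal hUdiv hπ hPsa hPn hσ hzr hr sol_continuousOn sol_init
    sol_hasDerivWithinAt sol_proj sol_fix sol_real sol_div sol_bound
    (tendstoUniformlyOn_of_solution K hν hUv hUreal hUdiv hπ hPsa hPn hσ hT hzr hzfix hzreal hzdiv hr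
      sol_continuousOn sol_init sol_hasDerivWithinAt sol_proj sol_fix sol_real sol_div sol_bound hw hw0 hw'
      hCw hwdec hwfix hwreal hwdiv)).2

end Smooth

end Summit.NavierStokesRegularity.FluidComputer.TransportGalerkinSmooth

end
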